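import Mathlib

/-!
# SoloInformed (s20) — the unit-index step behind the trace-formula weights

In the Eichler–Shimizu trace formula for the Shimura curve attached to a totally real field `F`
with `h⁺(F) = h(F)` the centraliser weights need the Hasse unit index
`Q_K = [O_K^× : μ_K · O_F^×]` of every CM quadratic extension `K/F` to be `1`.
The arithmetic input is: (i) `N_{K/F}(O_K^×) ⊆ U_F^+ = (O_F^×)^2` when `h⁺ = h`;
(ii) `N_{K/F}` restricted to `O_F^×` is squaring; (iii) norm-one units of a CM field are
roots of unity (Kronecker).  The deduction `O_K^× = μ_K · O_F^×` is the abstract group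
statement below (E = units of K, U = units of F, T = torsion, N = norm).
-/

namespace Summit.Langlands.Langlands.Theorems

/-- If every norm is the square of a base unit, the norm squares base units, and norm-one
elements are torsion, then every unit is (torsion) · (base unit). -/
theorem soloInformed_units_eq_torsion_mul_base
    {E : Type*} [CommGroup E] (U T : Subgroup E) (N : E →* E)
    (hN : ∀ e, ∃ u ∈ U, N e = u * u)
    (hNU : ∀ u ∈ U, N u = u * u)
    (hker : ∀ e, N e = 1 → e ∈ T) :
    ∀ e : E, ∃ t ∈ T, ∃ u ∈ U, e = t * u := by
  intro e
  obtain ⟨u, huU, hu⟩ := hN e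
  refine ⟨e * u⁻¹, hker _ ?_, u, huU, by simp⟩
  rw [map_mul, map_inv, hu, hNU u huU]
  simp

/-- Consequently the index-type quotient is trivial: the subgroup generated by torsion and
base units is everything. -/
theorem soloInformed_torsion_sup_base_eq_top
    {E : Type*} [CommGroup E] (U T : Subgroup E) (N : E →* E)
    (hN : ∀ e, ∃ u ∈ U, N e = u * u)
    (hNU : ∀ u ∈ U, N u = u * u)
    (hker : ∀ e, N e = 1 → e ∈ T) :
    T ⊔ U = ⊤ := by
  rw [eq_top_iff]
  intro e _
  obtain ⟨t, ht, u, hu, rfl⟩ := soloInformed_units_eq_torsion_mul_base U T N hN hNU hker e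
  exact Subgroup.mul_mem _ (Subgroup.mem_sup_left ht) (Subgroup.mem_sup_right hu)

end Summit.Langlands.Langlands.Theorems
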